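import Mathlib
import Literature.NumberTheory.Transcendental.LindemannWeierstrassProofs
import Literature.NumberTheory.Transcendental.PeriodsWave0
import Literature.NumberTheory.Transcendental.SchanuelEclEmptyProofs
import Literature.Barriers.Schanuel.AlgebraicIndependenceOfLogarithms
import Literature.Barriers.Schanuel.NesterenkoModularScope
import Summits.Schanuel.Schanuel.Theorems.RigidCoreDefs

/-!
# Calibration of stub A of line `generic-period-fibre` (crux `RigidCore.SchanuelOnLogFreeCore`)

Crux `stmt-Schanuel-0970` (`Summit.Schanuel.Schanuel.Theses.RigidCore.SchanuelOnLogFreeCore`: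
Schanuel's conjecture on the log-free core `C_EA`), line `generic-period-fibre`.  The line splits the
crux as `A ∧ B ⟹ crux`; stub A (`stub_schanuelOnKernelFreeCore`) is Schanuel's statement for
`ℚ`-linearly independent tuples drawn from the KERNEL-FREE CORE
`M = kernelFreeCore = sInf {K ≤ ℂ | K exp-closed, K relatively algebraically closed}`
(`ℚ^{EA} ∩ ℂ`, Macintyre's sector: A. Macintyre, *Schanuel's conjecture and free exponential
rings*, Ann. Pure Appl. Logic 51 (1991) 241–246, where Schanuel's conjecture restricted to the
exponential-algebraic numbers is isolated as the statement governing all "exponential constants").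
Stub A is an OPEN sub-conjecture of Schanuel's conjecture.  This file CALIBRATES it — it records,
kernel-checked, exactly where stub A provably stops — and credits nothing towards the crux:

* `CalibrationA.kernelFreeCore_rank_one` — stub A at `n = 1` HOLDS (Hermite–Lindemann, tree fact
  `Literature.NumberTheory.Transcendental.transcendental_exp_holds`, PROVED): for `x ≠ 0` one of
  `x`, `eˣ` is transcendental, so `1 ≤ trdeg ℚ(x, eˣ)`.
* `CalibrationA.kernelFreeCore_of_isAlgebraic` (and the primed form in the stub's own format) —
  stub A HOLDS for tuples of ALGEBRAIC numbers, in every rank (Lindemann–Weierstrass, tree fact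
  `Literature.NumberTheory.Transcendental.algebraicIndependent_exp_holds`, PROVED): the `e^{xᵢ}` are
  algebraically independent.  (Algebraic numbers lie in `M`: `mem_kernelFreeCore_of_isAlgebraic_rat`
  of `RigidCoreDefs.lean`.)
* `CalibrationA.expOnePi_of_schanuelOnKernelFreeCore` = **`stub_calibA_expOnePi`** (registered
  stub, signature verbatim) — stub A (as a hypothesis) IMPLIES the tree's registered open statement
  `Literature.NumberTheory.Transcendental.ExpOnePiAlgebraicIndependent` (`e` and `π` algebraically
  independent; "it is unknown whether `e` and `π` are algebraically independent", M. Bays and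
  J. Kirby, *Pseudo-exponential maps, variants, and quasiminimality*, Algebra Number Theory 12
  (2018), arXiv:1512.04262, p. 3).  Proof by DICHOTOMY on `π ∈ M` (no hull lemma needed): if
  `π ∈ M` then `(1, πi) ⊂ M` and stub A at rank 2 gives `trdeg ℚ(1, πi, e, −1) ≥ 2`, i.e.
  `trdeg ℚ(e, π) ≥ 2`; if `π ∉ M` then, `M` being relatively algebraically closed with
  `e = exp 1 ∈ M`, `π` is transcendental over `M ⊇ ℚ(e)` and `e` is transcendental
  (Hermite–Lindemann), so again `trdeg ℚ(e, π) ≥ 2` by the tower law.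
* `CalibrationA.expExp_of_schanuelOnKernelFreeCore` — likewise stub A at `x = (1, e) ⊂ M` gives the
  open `AlgebraicIndependent ℚ ![exp 1, exp (exp 1)]` (`e ⊥ e^e`).

So the first open instance of stub A is `ExpOnePiAlgebraicIndependent`, which the tree registers as
an `@[conjecture]` open statement (`Literature/NumberTheory/Transcendental/PeriodsWave0.lean`; no
`_holds` discharge exists or is expected).  Consequently this file closes nothing: it is the
kernel-checked statement of WHERE STUB A STOPS (rank 1 and algebraic tuples are theorems; rank 2 at
`(1, πi)` is already `e ⊥ π`), for planners to cite by name.  All auxiliary results live in the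
sub-namespace `Summit.Schanuel.Schanuel.Theorems.RigidCore.CalibrationA`; only the registered stub
`stub_calibA_expOnePi` is declared directly in `Summit.Schanuel.Schanuel.Theorems.RigidCore`.

Sources: Hermite–Lindemann and Lindemann–Weierstrass (A. Baker, *Transcendental Number Theory*
(1975), Ch. 1 Thm 1.4) through the tree facts named above; Bays–Kirby 2018 p. 3 for the open status
of `e ⊥ π`; Macintyre 1991 for Schanuel's conjecture on `ℚ^{EA}`; the field-theoretic glue
(`algebraicIndependent_of_le_trdeg_adjoin`, `algebraicIndependent_real_of_complex`,
`trdeg_adjoin_union_eq_of_isAlgebraic`, `add_le_trdeg_adjoin_union`, `linearIndependent_one_piI`)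
is the tree's (`Literature.Barriers.Schanuel.*`, `Literature.NumberTheory.Transcendental.*`).
-/

noncomputable section

namespace Summit.Schanuel.Schanuel.Theorems.RigidCore

open Complex IntermediateField
open Literature.NumberTheory.Transcendental

namespace CalibrationA

/-! ## Elementary helpers -/

/-- Algebraicity passes up along an inclusion `F ≤ E` of intermediate fields (map the
polynomial along the inclusion). -/
theorem isAlgebraic_of_le {F E : IntermediateField ℚ ℂ} (h : F ≤ E) {w : ℂ}
    (hw : IsAlgebraic F w) : IsAlgebraic E w := by
  obtain ⟨p, hp0, hpw⟩ := hw
  refine ⟨p.map (IntermediateField.inclusion h).toRingHom, ?_, ?_⟩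
  · exact (Polynomial.map_ne_zero_iff (IntermediateField.inclusion h).injective).2 hp0
  · rw [Polynomial.aeval_def, Polynomial.eval₂_map]
    rw [Polynomial.aeval_def] at hpw
    have hcomp : (algebraMap E ℂ).comp (IntermediateField.inclusion h).toRingHom =
        algebraMap F ℂ := by
      ext x; rfl
    rw [hcomp]; exact hpw

/-- `e = exp 1` lies in the kernel-free core `M` (which is `exp`-closed and contains `1`). -/
theorem exp_one_mem_kernelFreeCore : Complex.exp 1 ∈ kernelFreeCore :=
  exp_mem_kernelFreeCore (one_mem _)

/-- A transcendental element of an intermediate field forces positive transcendence degree. -/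
theorem one_le_trdeg_of_transcendental_mem {L : IntermediateField ℚ ℂ} {w : ℂ} (hw : w ∈ L)
    (ht : Transcendental ℚ w) : (1 : Cardinal) ≤ Algebra.trdeg ℚ L := by
  haveI : Algebra.Transcendental ℚ L :=
    ⟨⟨⟨w, hw⟩, fun h => ht (IntermediateField.isAlgebraic_iff.mp h)⟩⟩
  exact Cardinal.one_le_iff_pos.mpr (trdeg_pos ℚ L)

/-- Over an intermediate field `F`, an element `w` transcendental over `F` gives
`1 ≤ trdeg_F F(w)`. -/
theorem one_le_trdeg_adjoin_of_transcendental (F : IntermediateField ℚ ℂ) {w : ℂ}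
    (hw : Transcendental F w) :
    (1 : Cardinal) ≤ Algebra.trdeg F (adjoin F ({w} : Set ℂ)) := by
  let t : adjoin F ({w} : Set ℂ) := ⟨w, mem_adjoin_simple_self F w⟩
  have ht : Transcendental F t := fun halg => hw (halg.algHom (adjoin F ({w} : Set ℂ)).val)
  have hind : AlgebraicIndependent F ![t] := algebraicIndependent_iff_transcendental.mpr ht
  simpa using hind.cardinalMk_le_trdeg

/-- Monotonicity of `trdeg ℚ` along an inclusion of intermediate fields of `ℂ/ℚ`. -/
theorem trdeg_mono {L L' : IntermediateField ℚ ℂ} (h : L ≤ L') :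
    Algebra.trdeg ℚ L ≤ Algebra.trdeg ℚ L' :=
  trdeg_le_of_injective (IntermediateField.inclusion h) (IntermediateField.inclusion_injective h)

/-- `1, e` are `ℚ`-linearly independent (`e` is irrational, indeed transcendental by
Hermite–Lindemann at `α = 1`). -/
theorem linearIndependent_one_exp_one : LinearIndependent ℚ ![(1 : ℂ), Complex.exp 1] := by
  rw [LinearIndependent.pair_iff]
  intro s t hst
  have heT : Transcendental ℚ (Complex.exp 1) :=
    transcendental_exp_holds isAlgebraic_one one_ne_zero
  by_cases ht : t = 0
  · subst ht
    simp only [zero_smul, add_zero, smul_eq_zero, one_ne_zero, or_false] at hst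
    exact ⟨hst, rfl⟩
  · exfalso
    apply heT
    -- `e = -s/t` is rational
    have ht' : (t : ℂ) ≠ 0 := by exact_mod_cast ht
    have he : Complex.exp 1 = ((-s / t : ℚ) : ℂ) := by
      rw [Rat.smul_def, Rat.smul_def, mul_one] at hst
      push_cast
      field_simp
      linear_combination hst
    rw [he, show ((-s / t : ℚ) : ℂ) = algebraMap ℚ ℂ (-s / t) from (eq_ratCast _ _).symm]
    exact isAlgebraic_algebraMap _

/-! ## (a) Stub A in rank one (Hermite–Lindemann) -/

/-- **Stub A at `n = 1` HOLDS**: for `x ≠ 0` (in `M` or not), one of `x`, `eˣ` is transcendental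
(`eˣ` by Hermite–Lindemann if `x` is algebraic), so `1 ≤ trdeg ℚ(x, eˣ)`.  Verbatim the
statement of stub A specialised to `n = 1`. -/
theorem kernelFreeCore_rank_one :
    ∀ (x : Fin 1 → ℂ),
      (∀ i, x i ∈ (sInf {K : IntermediateField ℚ ℂ | (∀ w ∈ K, Complex.exp w ∈ K) ∧
        ∀ w : ℂ, IsAlgebraic K w → w ∈ K} : IntermediateField ℚ ℂ)) →
      LinearIndependent ℚ x →
        ((1 : ℕ) : Cardinal) ≤ Algebra.trdeg ℚ
          ↥(IntermediateField.adjoin ℚ (Set.range x ∪ Set.range (Complex.exp ∘ x))) := by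
  intro x _ hli
  have hx0 : x 0 ≠ 0 := hli.ne_zero 0
  set K := IntermediateField.adjoin ℚ (Set.range x ∪ Set.range (Complex.exp ∘ x)) with hK
  have key : ∃ t : ℂ, t ∈ K ∧ Transcendental ℚ t := by
    by_cases halg : IsAlgebraic ℚ (x 0)
    · exact ⟨Complex.exp (x 0), IntermediateField.subset_adjoin _ _ (Or.inr ⟨0, rfl⟩),
        transcendental_exp_holds halg hx0⟩
    · exact ⟨x 0, IntermediateField.subset_adjoin _ _ (Or.inl ⟨0, rfl⟩), halg⟩
  obtain ⟨t, htK, ht⟩ := key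
  haveI : Algebra.Transcendental ℚ K :=
    ⟨⟨⟨t, htK⟩, fun h => ht (IntermediateField.isAlgebraic_iff.mp h)⟩⟩
  have h := trdeg_pos ℚ K
  rw [← Cardinal.one_le_iff_pos] at h
  simpa using h

/-! ## (b) Stub A for tuples of algebraic numbers (Lindemann–Weierstrass) -/

/-- **Stub A HOLDS for algebraic tuples, in every rank**: if the `xᵢ` are algebraic (hence in `M`)
and `ℚ`-linearly independent, then the `e^{xᵢ}` are algebraically independent over `ℚ`
(Lindemann–Weierstrass), so `n ≤ trdeg ℚ(x, eˣ)`. -/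
theorem kernelFreeCore_of_isAlgebraic :
    ∀ (n : ℕ) (x : Fin n → ℂ), (∀ i, IsAlgebraic ℚ (x i)) → LinearIndependent ℚ x →
      (n : Cardinal) ≤ Algebra.trdeg ℚ
        ↥(IntermediateField.adjoin ℚ (Set.range x ∪ Set.range (Complex.exp ∘ x))) := by
  intro n x halg hli
  have hE : AlgebraicIndependent ℚ fun i => Complex.exp (x i) :=
    algebraicIndependent_exp_holds x halg hli
  set K := IntermediateField.adjoin ℚ (Set.range x ∪ Set.range (Complex.exp ∘ x)) with hK
  let f : Fin n → K := fun i =>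
    ⟨Complex.exp (x i), IntermediateField.subset_adjoin _ _ (Or.inr ⟨i, rfl⟩)⟩
  have hf : AlgebraicIndependent ℚ f := AlgebraicIndependent.of_comp K.val hE
  simpa using hf.cardinalMk_le_trdeg

/-- The algebraic-tuple layer in the stub's own format (membership in `M` is automatic for
algebraic numbers, `mem_kernelFreeCore_of_isAlgebraic_rat`). -/
theorem kernelFreeCore_of_isAlgebraic' :
    ∀ (n : ℕ) (x : Fin n → ℂ), (∀ i, IsAlgebraic ℚ (x i)) →
      (∀ i, x i ∈ (sInf {K : IntermediateField ℚ ℂ | (∀ w ∈ K, Complex.exp w ∈ K) ∧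
        ∀ w : ℂ, IsAlgebraic K w → w ∈ K} : IntermediateField ℚ ℂ)) ∧
      (LinearIndependent ℚ x →
        (n : Cardinal) ≤ Algebra.trdeg ℚ
          ↥(IntermediateField.adjoin ℚ (Set.range x ∪ Set.range (Complex.exp ∘ x)))) :=
  fun n x halg => ⟨fun i => mem_kernelFreeCore_of_isAlgebraic_rat (halg i),
    kernelFreeCore_of_isAlgebraic n x halg⟩

/-! ## (c) Stub A contains `e ⊥ π` (and `e ⊥ e^e`) -/

/-- **Stub A implies `e ⊥ π`.**  Dichotomy on `π ∈ M`: if `π ∈ M`, stub A at `(1, πi) ⊂ M`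
gives `2 ≤ trdeg ℚ(1, πi, e, e^{πi} = −1) ≤ trdeg ℚ(e, π, i) = trdeg ℚ(e, π)`; if `π ∉ M`, then
`π` is transcendental over the relatively algebraically closed field `M ∋ e`, hence over `ℚ(e)`,
and `e` is transcendental (Hermite–Lindemann at `α = 1`), so `trdeg ℚ(e, π) ≥ 1 + 1` by the
tower law.  Either way `![exp 1, π]` is algebraically independent (transfer to `ℝ` along
`Complex.ofReal`).  The hypothesis is stub A VERBATIM; the conclusion is the tree's registered
open statement `ExpOnePiAlgebraicIndependent`. -/
theorem expOnePi_of_schanuelOnKernelFreeCore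
    (h : ∀ (n : ℕ) (x : Fin n → ℂ),
      (∀ i, x i ∈ (sInf {K : IntermediateField ℚ ℂ | (∀ w ∈ K, Complex.exp w ∈ K) ∧
        ∀ w : ℂ, IsAlgebraic K w → w ∈ K} : IntermediateField ℚ ℂ)) →
      LinearIndependent ℚ x →
        (n : Cardinal) ≤ Algebra.trdeg ℚ
          ↥(IntermediateField.adjoin ℚ (Set.range x ∪ Set.range (Complex.exp ∘ x)))) :
    Literature.NumberTheory.Transcendental.ExpOnePiAlgebraicIndependent := by
  set l : Fin 2 → ℂ := fun i => ((![Real.exp 1, Real.pi] i : ℝ) : ℂ) with hl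
  suffices h2 : ((2 : ℕ) : Cardinal) ≤ Algebra.trdeg ℚ (adjoin ℚ (Set.range l)) by
    exact Literature.Barriers.Schanuel.algebraicIndependent_real_of_complex _
      (Literature.Barriers.Schanuel.algebraicIndependent_of_le_trdeg_adjoin l h2)
  have hl0 : l 0 = Complex.exp 1 := by simp [hl, Complex.ofReal_exp]
  have hl1 : l 1 = (Real.pi : ℂ) := by simp [hl]
  have he_mem : Complex.exp 1 ∈ adjoin ℚ (Set.range l) := hl0 ▸ subset_adjoin ℚ _ ⟨0, rfl⟩
  have hpi_mem : (Real.pi : ℂ) ∈ adjoin ℚ (Set.range l) := hl1 ▸ subset_adjoin ℚ _ ⟨1, rfl⟩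
  by_cases hpi : (Real.pi : ℂ) ∈ kernelFreeCore
  · -- Case `π ∈ M`: stub A at `(1, πi)`.
    have hI : I ∈ kernelFreeCore :=
      mem_kernelFreeCore_of_isAlgebraic_rat Literature.Barriers.Schanuel.isAlgebraic_I
    have hx : ∀ i, (![(1 : ℂ), (Real.pi : ℂ) * I] i) ∈ kernelFreeCore := by
      intro i
      fin_cases i
      · exact one_mem _
      · exact mul_mem hpi hI
    have h2 := h 2 _ hx Literature.Barriers.Schanuel.linearIndependent_one_piI
    have hI' : I ∈ adjoin ℚ (Set.range l ∪ {I}) := subset_adjoin ℚ _ (Or.inr rfl)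
    have hmono : adjoin ℚ (Set.range l) ≤ adjoin ℚ (Set.range l ∪ {I}) :=
      adjoin.mono ℚ _ _ Set.subset_union_left
    have hle : adjoin ℚ (Set.range ![(1 : ℂ), (Real.pi : ℂ) * I] ∪
        Set.range (Complex.exp ∘ ![(1 : ℂ), (Real.pi : ℂ) * I])) ≤
        adjoin ℚ (Set.range l ∪ {I}) := by
      rw [adjoin_le_iff]
      rintro w (⟨i, rfl⟩ | ⟨i, rfl⟩) <;> fin_cases i
      · exact one_mem _
      · simpa using mul_mem (hmono hpi_mem) hI'
      · simpa using hmono he_mem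
      · simp [Complex.exp_pi_mul_I]
    have hunion : Algebra.trdeg ℚ (adjoin ℚ (Set.range l ∪ {I})) =
        Algebra.trdeg ℚ (adjoin ℚ (Set.range l)) :=
      Literature.Barriers.Schanuel.trdeg_adjoin_union_eq_of_isAlgebraic (K := ℚ) (Set.range l)
        ({I} : Set ℂ) (fun x hx => by
          rw [Set.mem_singleton_iff.mp hx]
          exact Literature.Barriers.Schanuel.isAlgebraic_I)
    exact (h2.trans (trdeg_mono hle)).trans_eq hunion
  · -- Case `π ∉ M`: `π` is transcendental over `M ⊇ ℚ(e)`, and `e` is transcendental.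
    set F : IntermediateField ℚ ℂ := adjoin ℚ ({Complex.exp 1} : Set ℂ) with hF
    have hFM : F ≤ kernelFreeCore :=
      adjoin_le_iff.mpr (Set.singleton_subset_iff.mpr exp_one_mem_kernelFreeCore)
    have heT : Transcendental ℚ (Complex.exp 1) :=
      transcendental_exp_holds isAlgebraic_one one_ne_zero
    have ha : (1 : Cardinal) ≤ Algebra.trdeg ℚ F :=
      one_le_trdeg_of_transcendental_mem (mem_adjoin_simple_self ℚ _) heT
    have hπF : Transcendental F (Real.pi : ℂ) := fun halg =>
      hpi (mem_kernelFreeCore_of_isAlgebraic (isAlgebraic_of_le hFM halg))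
    have hb : (1 : Cardinal) ≤ Algebra.trdeg F (adjoin F ({(Real.pi : ℂ)} : Set ℂ)) :=
      one_le_trdeg_adjoin_of_transcendental F hπF
    have h2 : (1 : Cardinal) + 1 ≤
        Algebra.trdeg ℚ (adjoin ℚ (({Complex.exp 1} : Set ℂ) ∪ {(Real.pi : ℂ)})) :=
      add_le_trdeg_adjoin_union _ _ ha hb
    have hle : adjoin ℚ (({Complex.exp 1} : Set ℂ) ∪ {(Real.pi : ℂ)}) ≤
        adjoin ℚ (Set.range l) := by
      rw [adjoin_le_iff]
      rintro a (ha | ha)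
      · rw [Set.mem_singleton_iff.mp ha]; exact he_mem
      · rw [Set.mem_singleton_iff.mp ha]; exact hpi_mem
    have htwo : ((2 : ℕ) : Cardinal) = (1 : Cardinal) + 1 := by norm_num
    rw [htwo]
    exact h2.trans (trdeg_mono hle)

/-- **Stub A implies `e ⊥ e^e`** (open): stub A at `(1, e) ⊂ M` gives
`2 ≤ trdeg ℚ(1, e, e, e^e) = trdeg ℚ(e, e^e)`. -/
theorem expExp_of_schanuelOnKernelFreeCore
    (h : ∀ (n : ℕ) (x : Fin n → ℂ),
      (∀ i, x i ∈ (sInf {K : IntermediateField ℚ ℂ | (∀ w ∈ K, Complex.exp w ∈ K) ∧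
        ∀ w : ℂ, IsAlgebraic K w → w ∈ K} : IntermediateField ℚ ℂ)) →
      LinearIndependent ℚ x →
        (n : Cardinal) ≤ Algebra.trdeg ℚ
          ↥(IntermediateField.adjoin ℚ (Set.range x ∪ Set.range (Complex.exp ∘ x)))) :
    AlgebraicIndependent ℚ ![Complex.exp 1, Complex.exp (Complex.exp 1)] := by
  set l : Fin 2 → ℂ := ![Complex.exp 1, Complex.exp (Complex.exp 1)] with hl
  have hx : ∀ i, (![(1 : ℂ), Complex.exp 1] i) ∈ kernelFreeCore := by
    intro i
    fin_cases i
    · exact one_mem _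
    · exact exp_one_mem_kernelFreeCore
  have h2 := h 2 _ hx linearIndependent_one_exp_one
  have he : Complex.exp 1 ∈ adjoin ℚ (Set.range l) := subset_adjoin ℚ _ ⟨0, by simp [hl]⟩
  have hee : Complex.exp (Complex.exp 1) ∈ adjoin ℚ (Set.range l) :=
    subset_adjoin ℚ _ ⟨1, by simp [hl]⟩
  have hle : adjoin ℚ (Set.range ![(1 : ℂ), Complex.exp 1] ∪
      Set.range (Complex.exp ∘ ![(1 : ℂ), Complex.exp 1])) ≤ adjoin ℚ (Set.range l) := by
    rw [adjoin_le_iff]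
    rintro w (⟨i, rfl⟩ | ⟨i, rfl⟩) <;> fin_cases i
    · exact one_mem _
    · simpa using he
    · simpa using he
    · simpa using hee
  exact Literature.Barriers.Schanuel.algebraicIndependent_of_le_trdeg_adjoin l
    (h2.trans (trdeg_mono hle))

end CalibrationA

/-! ## The registered stub -/

/-- **Registered stub `stub_calibA_expOnePi` of line `generic-period-fibre`** (signature verbatim):
stub A — Schanuel's statement for `ℚ`-linearly independent tuples from the kernel-free core
`M = sInf {K ≤ ℂ | K exp-closed, relatively algebraically closed}` — implies the tree's OPEN
statement `ExpOnePiAlgebraicIndependent` (`e` and `π` algebraically independent).  This calibrates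
stub A (its rank-2 instance at `(1, πi)`, resp. the transcendence of `π` over `M`, is already
`e ⊥ π`); it closes nothing.  Proof: `CalibrationA.expOnePi_of_schanuelOnKernelFreeCore`. -/
theorem stub_calibA_expOnePi :
    (∀ (n : ℕ) (x : Fin n → ℂ),
      (∀ i, x i ∈ (sInf {K : IntermediateField ℚ ℂ | (∀ w ∈ K, Complex.exp w ∈ K) ∧
        ∀ w : ℂ, IsAlgebraic K w → w ∈ K} : IntermediateField ℚ ℂ)) →
      LinearIndependent ℚ x →
        (n : Cardinal) ≤ Algebra.trdeg ℚ
          ↥(IntermediateField.adjoin ℚ (Set.range x ∪ Set.range (Complex.exp ∘ x)))) →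
    Literature.NumberTheory.Transcendental.ExpOnePiAlgebraicIndependent :=
  fun h => CalibrationA.expOnePi_of_schanuelOnKernelFreeCore h

end Summit.Schanuel.Schanuel.Theorems.RigidCore

end
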